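import Literature.MeasureTheory.Group.OrbitalMeasureOfProd
import Literature.MeasureTheory.Group.InvariantQuotientProdNormalized
import Literature.MeasureTheory.Group.InvariantQuotientTransport
import HarnessLib

/-!
# `orbitalMeasureOfProd` of two QUOTIENT measures is the quotient measure of the transported product Haar measures (Weil constant ONE)
(Gelbart, *Automorphic forms on adele groups* (1975), p. 155 (10.19); Folland (1995) §2.6 Thm. 2.49 ∕ (2.52); Rogawski (1990) §5.4 p. 72:
`G(𝔸) = G_∞ × G(𝔸_f)`, `dg = dg_∞ ⊗ dg_f`, `dt = dt_∞ ⊗ dt_f`)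

Topic `MeasureTheory/Group`; THEOREMS ONLY (no definition, no instance, no named fact).  ★ `OrbitalMeasureOfProd` CONSTRUCTS the product orbital
measure `μ₁ ⊠ μ₂` on `G ⧸ C(γ)` along `e : G₁ × G₂ ≃* G`, `γ = e(γ₁, γ₂)`; ★ `InvariantQuotientProdNormalized` proves `(ν₁ ⊗ ν₂) ∕ (ρ₁ ⊗ ρ₂) =
(ν₁ ∕ ρ₁) ⊠ (ν₂ ∕ ρ₂)` on `(G₁ × G₂) ⧸ (H₁ × H₂)`; ★ `InvariantQuotientTransport` moves quotient measures along `cosetCongr e`.  Composed: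

* **`orbitalMeasureOfProd_quotientMeasure_eq_quotientMeasure`** — `orbitalMeasureOfProd e hγ (ν₁ ∕ t₁) (ν₂ ∕ t₂) = ν ∕ t` on `G ⧸ C(γ)` for `ν = e_*(ν₁ ⊗ ν₂)`
  and `t = (e|_{C(γ₁) × C(γ₂)})_* t_P`, `t_P ↔ t₁ ⊗ t₂` — the `∞ × f` step of «the orbital measure built from local quotient measures IS the global
  quotient measure» (sibling ★ `RestrictedProduct/QuotientMeasureNormalized` is the restricted-product step).

## References
* S. Gelbart, *Automorphic forms on adele groups* (1975), p. 155 (10.19) [Gelbart1975].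
* G. B. Folland, *A Course in Abstract Harmonic Analysis* (1995), §2.6 Thm. 2.49 [Folland1995].
* J. D. Rogawski, *Automorphic Representations of Unitary Groups in Three Variables* (1990), §5.4 p. 72 [Rogawski1990].
-/

set_option autoImplicit false

noncomputable section

open _root_.MeasureTheory _root_.MeasureTheory.Measure Set Filter Function
open _root_.Topology
open scoped ENNReal NNReal Pointwise

/-! ## The `∞ × f` step: `orbitalMeasureOfProd` of two quotient measures -/

namespace Literature.MeasureTheory.Group

section ProdQuot

variable {G₁ G₂ G : Type*} [Group G₁] [Group G₂] [Group G]
  [TopologicalSpace G₁] [TopologicalSpace G₂] [TopologicalSpace G]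
  [IsTopologicalGroup G₁] [IsTopologicalGroup G₂] [IsTopologicalGroup G]
  [LocallyCompactSpace G₁] [LocallyCompactSpace G₂] [LocallyCompactSpace G]
  [SecondCountableTopology G₁] [SecondCountableTopology G₂] [SecondCountableTopology G]
  [T2Space G₁] [T2Space G₂] [T2Space G]
  [MeasurableSpace G₁] [BorelSpace G₁] [MeasurableSpace G₂] [BorelSpace G₂] [MeasurableSpace G] [BorelSpace G]
  (e : G₁ × G₂ ≃* G) (he : Continuous e) (hes : Continuous e.symm) {γ : G} {γ₁ : G₁} {γ₂ : G₂} (hγ : e (γ₁, γ₂) = γ)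
  [MeasurableSpace (G ⧸ Subgroup.centralizer ({γ} : Set G))] [BorelSpace (G ⧸ Subgroup.centralizer ({γ} : Set G))]
  [MeasurableSpace (G₁ ⧸ Subgroup.centralizer ({γ₁} : Set G₁))] [BorelSpace (G₁ ⧸ Subgroup.centralizer ({γ₁} : Set G₁))]
  [MeasurableSpace (G₂ ⧸ Subgroup.centralizer ({γ₂} : Set G₂))] [BorelSpace (G₂ ⧸ Subgroup.centralizer ({γ₂} : Set G₂))]
  [hC₁ : IsClosed ((Subgroup.centralizer ({γ₁} : Set G₁) : Subgroup G₁) : Set G₁)]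
  [hC₂ : IsClosed ((Subgroup.centralizer ({γ₂} : Set G₂) : Subgroup G₂) : Set G₂)]
  (t₁ : Measure (Subgroup.centralizer ({γ₁} : Set G₁))) [t₁.IsMulLeftInvariant] [IsFiniteMeasureOnCompacts t₁]
  [t₁.IsOpenPosMeasure] [t₁.IsInvInvariant] [SFinite t₁]
  (t₂ : Measure (Subgroup.centralizer ({γ₂} : Set G₂))) [t₂.IsMulLeftInvariant] [IsFiniteMeasureOnCompacts t₂]
  [t₂.IsOpenPosMeasure] [t₂.IsInvInvariant] [SFinite t₂]
  (tP : Measure ((Subgroup.centralizer ({γ₁} : Set G₁)).prod (Subgroup.centralizer ({γ₂} : Set G₂))))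
  [tP.IsMulLeftInvariant] [IsFiniteMeasureOnCompacts tP] [tP.IsOpenPosMeasure] [tP.IsInvInvariant] [SFinite tP]
  (t : Measure (Subgroup.centralizer ({γ} : Set G))) [t.IsMulLeftInvariant] [IsFiniteMeasureOnCompacts t]
  [t.IsOpenPosMeasure] [t.IsInvInvariant] [SFinite t]
  (ν₁ : Measure G₁) [IsHaarMeasure ν₁] [ν₁.IsMulRightInvariant]
  (ν₂ : Measure G₂) [IsHaarMeasure ν₂] [ν₂.IsMulRightInvariant]
  (ν : Measure G) [IsHaarMeasure ν] [ν.IsMulRightInvariant]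

/-- **`orbitalMeasureOfProd` of two quotient measures is the quotient measure for the transported product Haar measures** (Weil constant
one): with `γ = e(γ₁, γ₂)`, `t_P ↔ t₁ ⊗ t₂` on `C(γ₁) × C(γ₂)`, `t = (e|_{C(γ₁) × C(γ₂)})_* t_P` on `C(γ) = e(C(γ₁) × C(γ₂))` and
`ν = e_*(ν₁ ⊗ ν₂)`: `orbitalMeasureOfProd e hγ (ν₁ ∕ t₁) (ν₂ ∕ t₂) = ν ∕ t` — the `G(𝔸) = G_∞ × G(𝔸_f)` step of «`dg ∕ dt` built from local
quotient measures IS the global quotient measure» [Gelbart (1975) (10.19); Rogawski (1990) §5.4 p. 72]. [cite: Gelbart1975, p. 155 (10.19)] -/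
theorem orbitalMeasureOfProd_quotientMeasure_eq_quotientMeasure (hC : IsClosed ((Subgroup.centralizer ({γ} : Set G) : Subgroup G) : Set G))
    (htP : Measure.map (Subgroup.prodEquiv (Subgroup.centralizer ({γ₁} : Set G₁)) (Subgroup.centralizer ({γ₂} : Set G₂))) tP = t₁.prod t₂)
    (ht : t = Measure.map (subgroupCongrHomeomorph e ((Subgroup.centralizer ({γ₁} : Set G₁)).prod (Subgroup.centralizer ({γ₂} : Set G₂)))
      (Subgroup.centralizer ({γ} : Set G)) (forall_apply_mem_centralizer_iff e hγ) he hes) tP)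
    (hν : ν = Measure.map e (ν₁.prod ν₂)) :
    orbitalMeasureOfProd e hγ (quotientMeasure (Subgroup.centralizer ({γ₁} : Set G₁)) t₁ hC₁ ν₁)
        (quotientMeasure (Subgroup.centralizer ({γ₂} : Set G₂)) t₂ hC₂ ν₂) =
      quotientMeasure (Subgroup.centralizer ({γ} : Set G)) t hC ν := by
  haveI := hC
  haveI hP : IsClosed ((((Subgroup.centralizer ({γ₁} : Set G₁)).prod (Subgroup.centralizer ({γ₂} : Set G₂)) :
      Subgroup (G₁ × G₂)) : Set (G₁ × G₂))) := isClosed_coe_prod _ _ hC₁ hC₂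
  letI : MeasurableSpace ((G₁ × G₂) ⧸ (Subgroup.centralizer ({γ₁} : Set G₁)).prod (Subgroup.centralizer ({γ₂} : Set G₂))) := borel _
  haveI : BorelSpace ((G₁ × G₂) ⧸ (Subgroup.centralizer ({γ₁} : Set G₁)).prod (Subgroup.centralizer ({γ₂} : Set G₂))) := ⟨rfl⟩
  rw [orbitalMeasureOfProd_eq_map e hγ _ _ he hes, coe_cosetCongrHomeomorph,
    map_quotientProdHomeomorph_symm_prod_quotientMeasure_eq _ _ t₁ t₂ tP htP ν₁ ν₂]
  exact map_cosetCongr_quotientMeasure e he hes _ (Subgroup.centralizer ({γ} : Set G)) (forall_apply_mem_centralizer_iff e hγ)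
    tP t (ν₁.prod ν₂) ν ht hν

end ProdQuot

end Literature.MeasureTheory.Group
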